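import Summits.HodgeConjecture.CorCM.D2Bridge.HcmPiecesAtPin
import HarnessLib

/-!
# Δ2 bridge — the R3 residual (J-record + pieces) at the LIVE pin from ONE object: a component-Albanese record at instance `ι₁`

WORLD = C (coordinator ruling 2026-08-23 ≈23:30Z, provisional): the live `ι₁`-keyed dictionary `HodgeCM.Model.liuDictionaryPin` is the
Liu-verbatim keying; the END of record (`CorCM/PortJoin/ClosedPrinted.lean`, edition 1) displays the Δ2 residual R3 = {`M`, `jH`, `hjHinj`,
`hjH`, `pieces`} BY NAME.  This file isolates the ONE tree object whose construction would discharge all five BY VALUE at the live pin: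
a component-Albanese record `J₁ : ComponentAlbanese … C HT` elaborated under the instance `algebraMap L ℂ = ι₁` (a cofan of the tree pieces
inside `X_K ⊗_{E,ι₁} ℂ`; the tree's only landed cofan, ✔ `AlbaneseOnPieceCofan` :181, is along `ῑ₁ = conj ∘ ι₁`, for which the `pieces`
slot is uninhabitable at good `PhiMu` lines — ✔ `OrientationReflexConj.not_forall_isReflexOfTypeG_starRingEnd_comp_imp`).

`exists_r3_of_componentAlbanese_iota1`: GIVEN such a `J₁` with its level law, the five R3 fields exist BY VALUE at the literal pin
`liuDictionaryPin hHD hI h₁ h₃ hA V I line`, at the END's own rest spelling `U.rest (restTailOne (AlgHom.id ℚ L) ι₁ …)`: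
`M := map43RecordAtPin J₁ (AlgHom.id ℚ L) ι₁ …` (d2bridge-prove-2), `jH := jHPin …` with ✔ `jHPin_injective ∕ jHPin_comm`, and
`pieces` from ✔ `nonempty_hcmPieces_atLiuDictionaryPin (ιg := ι₁)` (d2bridge-prove-3 ∕ -8) with the X3-Char transport discharged by the
displayed MIRROR identity `hsign : Φ_μ = typeOfLine (line i)` (T-SIGN, ✔ `OmegaPinTSign`).  THEOREMS ONLY; `J₁` is a HYPOTHESIS — nothing
here claims it is inhabited.  HC_CM is NOT proved; «Δ2 BRIDGE CLOSED» is NOT claimed.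

References: Y. Liu, *Camb. J. Math.* 9 (2021), Thm. 4.18 (1) and its proof (FJcycle.tex l. 2239, 2247–2253), Rem. 4.17, Lem. 2.4 (1),
Def. 4.5 (2), Def. 4.12.
-/

set_option autoImplicit false

noncomputable section

open scoped TensorProduct
open CategoryTheory NumberField Function
open Literature.AlgebraicGeometry.Motives (AbelianVariety bettiCohomology)
open Literature.AlgebraicGeometry.HodgeTheory
open Literature.AlgebraicGeometry.ShimuraVarieties.UnitaryCanonicalModel (exists_recordSystem)
open Literature.NumberTheory.Automorphic Literature.NumberTheory.Automorphic.Liu2021 Literature.NumberTheory.Automorphic.Liu2021.AppendixC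
open Literature.NumberTheory.Automorphic.Liu2021.AppendixC.RestOne
open Literature.NumberTheory.Automorphic.PicardCM
open Literature.NumberTheory.Transcendental (Arapura2012_Cor_15_4_6)
open HodgeCM HodgeCM.Model HodgeCM.Model.LevelTranslate HodgeCM.Model.TowerLevel HodgeCM.Model.TowerCarrier
open Summit.HodgeConjecture.CorCM.D2Bridge.TowerRational

namespace Summit.HodgeConjecture.CorCM.D2Bridge

open HodgeCM.Literature.Theta.LiuAlbaneseModuleDatum.D2Bridge (HcmPieces)

variable {L : HodgeCM.CMField} [IsGalois ℚ (L : Type)] {ι₁ : L →+* ℂ}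
variable {V : HodgeCM.HermSpace3 L ι₁} {Φ : Literature.AlgebraicGeometry.Motives.CMType L} {isotropicAt : ℕ → Prop}
variable {μ : Literature.NumberTheory.Automorphic.IdeleClassGroup L →ₜ* Circle}
  (hμ : Literature.NumberTheory.Automorphic.IdeleClassGroup.IsConjugateSymplectic L μ)
  (hw : Literature.NumberTheory.Automorphic.IdeleClassGroup.HasWeight L μ 1) (Car : Def45.Carriers L μ)

set_option synthInstance.maxHeartbeats 400000 in
set_option maxHeartbeats 3200000 in
/-- **R3 BY VALUE AT THE LIVE PIN FROM A COMPONENT-ALBANESE RECORD AT INSTANCE `ι₁`.**  For the literal pin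
`T := liuDictionaryPin hHD hI h₁ h₃ hA V I line`, an index line `i` with the MIRROR identity `hsign : Φ_μ = typeOfLine (line i)`, a μ-uniform Weil
carrier `U`, the one-object rest presented along `ι₁`, and a component-Albanese record `J₁` under `algebraMap L ℂ = ι₁` with its level law: there are
`M` (Liu's (4.3) record over RATIONAL carriers at the rest `U.rest (restTailOne (AlgHom.id ℚ L) ι₁ …)`) and `jH : M.HB →ₗ T.H` injective and
`U(V)(𝔸_f)`-equivariant such that `HcmPieces (toThm418Data C (U.rest …)) M T.H jH K.K H¹(P_K;ℂ) (resTotal K) (T.cmClasses K i)` is inhabited at every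
level `K ≤ Level.capThree K₀` — i.e. the four J-record binders and the `pieces` binder of ✔ `PinSignatures.thm418C_liuDictionaryPin_of_pins` at line
`i`, BY VALUE.  [cite: Liu2021, Theorem 4.18 (1) with its proof (FJcycle.tex l. 2239, 2247–2253), Lemma 2.4 (1) (l. 1210–1228), Definition 4.5 (2) (l. 1944–1951)] -/
theorem exists_r3_of_componentAlbanese_iota1 {hHD : exists_isReal_hodgeModel} {hI : hodgePQ_independent_of_hodgeModel}
    {h₁ : BallQuotientUniformised} {h₃ : CMAbelianVarietyRealised} {hA : Arapura2012_Cor_15_4_6} {h : exists_recordSystem}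
    {C : Sec42Data (Model.honestP5Of h ⟨L.K⟩ ι₁ ⟨V.Hm, V.isHermitian, V.signature_ι₁, V.posDef_of_ne⟩ Φ) isotropicAt}
    {HT : C.HeckeTranslates}
    [inst : Algebra (L : Type) ℂ] (hinst : ∀ x : L, algebraMap (L : Type) ℂ x = ι₁ x)
    (I : Type) (line : I → HodgeCM.Model.SplitLineE V) (U : UniformOmega C)
    (J₁ : ComponentAlbanese hHD hI (ballQuotientUniformisedDatum_of h₁) h₃ hA V h Φ C HT)
    (hΓ₁ : ∀ K₁ : C5.SmallLevel C.S.K₀, ((J₁.Γof K₁).K : Subgroup ↥V.adelicFin) = (K₁.1 : Subgroup C.G))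
    (Dμ : ObjOne (AlgHom.id ℚ (L : Type)) ι₁ hμ hw Car) (τ' : L →+* ℂ) (hτ' : τ' ∈ hμ.cmType.1) (i : I)
    (hsign : hμ.cmType = HodgeCM.Model.SplitLine.typeOfLine (line i)) :
    ∃ (M : (toThm418Data C (U.rest (restTailOne (AlgHom.id ℚ (L : Type)) ι₁ hμ hw Car
          (HT.rhoΩOne (AlgHom.id ℚ (L : Type)) ι₁ hμ hw Car)))).Map43RationalData)
      (jH : M.HB →ₗ[ℂ] (HodgeCM.Model.liuDictionaryPin hHD hI h₁ h₃ hA V I line).H),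
      Function.Injective jH ∧
      (∀ (g : ↥V.adelicFin) (x : M.HB), jH (M.ρB g x) = MonoidAlgebra.of ℂ ↥V.adelicFin g • jH x) ∧
      ∀ K : HodgeCM.Level V, K ≤ Level.capThree (V := V) (C.S.K₀.1 : Subgroup ↥V.adelicFin) C.S.K₀.2.1 →
        Nonempty (HcmPieces.{0, 1, 0}
          (toThm418Data C (U.rest (restTailOne (AlgHom.id ℚ (L : Type)) ι₁ hμ hw Car
            (HT.rhoΩOne (AlgHom.id ℚ (L : Type)) ι₁ hμ hw Car))))
          M (HodgeCM.Model.liuDictionaryPin hHD hI h₁ h₃ hA V I line).H jH K.K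
          ((picardCMUniverse hHD hI h₁ h₃).CohC ((picardCMUniverse hHD hI h₁ h₃).pms L ι₁ V K) 1)
          (resTotal hHD hI (ballQuotientUniformisedDatum_of h₁) h₃ hA K)
          ((HodgeCM.Model.liuDictionaryPin hHD hI h₁ h₃ hA V I line).cmClasses K i)) :=
  ⟨map43RecordAtPin J₁ (AlgHom.id ℚ (L : Type)) ι₁ hμ hw Car U.Eps U.epsOf U.Chi (U.omega μ hμ) (U.rho μ hμ) Dμ τ' hτ',
    jHPin J₁ (AlgHom.id ℚ (L : Type)) ι₁ hμ hw Car U.Eps U.epsOf U.Chi (U.omega μ hμ) (U.rho μ hμ) Dμ τ' hτ',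
    jHPin_injective J₁ (AlgHom.id ℚ (L : Type)) ι₁ hμ hw Car U.Eps U.epsOf U.Chi (U.omega μ hμ) (U.rho μ hμ) Dμ τ' hτ',
    jHPin_comm J₁ (AlgHom.id ℚ (L : Type)) ι₁ hμ hw Car U.Eps U.epsOf U.Chi (U.omega μ hμ) (U.rho μ hμ) Dμ τ' hτ',
    fun K hK => nonempty_hcmPieces_atLiuDictionaryPin hμ hw Car ι₁ hinst I line U J₁ hΓ₁ Dμ τ' hτ' i K hK
      fun _ hd => hsign ▸ hd⟩

end Summit.HodgeConjecture.CorCM.D2Bridge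

end
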